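import Literature.NumberTheory.CubicFields.DavenportHeilbronnMaximality
import Literature.NumberTheory.CubicFields.DeloneFaddeevIrreducible
import Mathlib.Algebra.QuadraticAlgebra.Basic
import HarnessLib

/-!
# Reducible cubic rings: `R((0, 1, c, d)) ≅ ℤ × ℤ[x]/(x² + cx + d)` and the reducible maximal normal form

Topic `Literature/NumberTheory/CubicFields`, continuing the Levi–Delone–Faddeev and
Davenport–Heilbronn files (`RingOfForm f`, `GL2ZEquiv`, `BinaryCubic.IsIrreducible`,
`RingOfForm.IsMaximal`, `BinaryCubic.MemU`).

Bhargava–Taniguchi–Thorne 2023, §2.1 and §4 ("reducible rings"): cubic rings which are not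
integral domains correspond to REDUCIBLE binary cubic forms; the maximal nondegenerate ones are
the maximal orders of the étale algebras `ℚ × K` (`K` a quadratic field) and `ℚ × ℚ × ℚ`, counted
in Prop. 4.2 by the number of quadratic fields (`N₂^±(X)`). This file provides the algebra:

* `BinaryCubic.exists_gl2zEquiv_a_eq_zero` — **a reducible form is `GL₂(ℤ)`-equivalent to one
  with `a = 0`** (move a primitive zero to `(1 : 0)`);
* `RingOfForm.prodQuadEquiv c d` — **`R((0, 1, c, d)) ≅ ℤ × ℤ[t]/(t² + ct + d)`** (Mathlib's
  `QuadraticAlgebra ℤ (−d) (−c)`): `ω` is the idempotent `(1, 0)` and `θ ↦ (0, t)`;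
* `BinaryCubic.subst_shear`, `disc_reducibleNormalForm` — `(0, 1, c, d) ∘ (1 0; k 1) = (0, 1, c + 2k, k² + ck + d)`
  and `Disc(0, 1, c, d) = c² − 4d`;
* `RingOfForm.exists_normalForm_of_isMaximal` — **a maximal, reducible, nondegenerate `R(f)` has
  `f ~ (0, 1, c, d)` with `c ∈ {0, 1}`** (maximality at the primes dividing `b` forces `b = ±1`),
  so `R(f) ≅ ℤ × S` with `S` the quadratic ring of discriminant `Disc(f) = c² − 4d`.

NOT here: the maximality criterion for these rings (`S` maximal ⇔ `c² − 4d` fundamental or `1`,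
BTT Prop. 4.2) and the count.

## References

* M. Bhargava, T. Taniguchi, F. Thorne, *Improved error estimates for the Davenport–Heilbronn
  theorems*, Math. Ann. 389 (2024) = arXiv:2107.12819, §2.1, §4 (reducible rings) [BhargavaTaniguchiThorne2023].
* M. Bhargava, A. Shankar, J. Tsimerman, *On the Davenport–Heilbronn theorems and second order
  terms*, Invent. Math. 193 (2013), §2–3 [BhargavaShankarTsimerman2012].
-/

namespace Literature.NumberTheory.CubicFields

open BinaryCubic

namespace BinaryCubic

/-- A form vanishing at a PRIMITIVE integral point is `GL₂(ℤ)`-equivalent to a form with `a = 0`: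
complete `(m, n)` to `γ = (m n; ∗ ∗) ∈ SL₂(ℤ)`; then `(f ∘ γ).a = f(m, n) = 0`. [folklore] -/
theorem exists_gl2zEquiv_a_eq_zero_of_isCoprime {f : BinaryCubic ℤ} {m n : ℤ} (hmn : IsCoprime m n)
    (h : f.eval m n = 0) : ∃ g : BinaryCubic ℤ, GL2ZEquiv f g ∧ g.a = 0 := by
  obtain ⟨u, v, huv⟩ := hmn
  let γ : Matrix (Fin 2) (Fin 2) ℤ := !![m, n; -v, u]
  have hdet : γ.det = 1 := by
    rw [Matrix.det_fin_two_of]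
    linear_combination huv
  refine ⟨twist γ f, ⟨γ, by rw [hdet]; exact isUnit_one, rfl⟩, ?_⟩
  rw [twist, hdet, one_smul, ← h]
  simp [BinaryCubic.subst, BinaryCubic.eval, γ]

/-- **A reducible form is `GL₂(ℤ)`-equivalent to a form with `a = 0`** (it has a zero in `P¹(ℚ)`,
hence a primitive integral zero). [folklore] -/
theorem exists_gl2zEquiv_a_eq_zero {f : BinaryCubic ℤ} (h : ¬ f.IsIrreducible) :
    ∃ g : BinaryCubic ℤ, GL2ZEquiv f g ∧ g.a = 0 := by
  rw [isIrreducible_iff_eval_ne_zero] at h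
  push Not at h
  obtain ⟨u, v, huv, h0⟩ := h
  -- divide by `g = gcd(u, v)`
  set g := Int.gcd u v with hg
  have hg0 : (g : ℤ) ≠ 0 := by
    rw [hg]
    exact_mod_cast (Int.gcd_eq_zero_iff.not.mpr (not_and_or.mpr (huv.imp id id)))
  obtain ⟨m, hm⟩ : (g : ℤ) ∣ u := hg ▸ Int.gcd_dvd_left u v
  obtain ⟨n, hn⟩ : (g : ℤ) ∣ v := hg ▸ Int.gcd_dvd_right u v
  have hcop : IsCoprime m n := by
    rw [Int.isCoprime_iff_gcd_eq_one]
    have h1 := Int.gcd_div_gcd_div_gcd (i := u) (j := v) (by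
      rw [← hg]; exact Nat.pos_of_ne_zero (by exact_mod_cast hg0))
    rw [← hg] at h1
    have hmu : u / g = m := by rw [hm]; exact Int.mul_ediv_cancel_left m hg0
    have hnv : v / g = n := by rw [hn]; exact Int.mul_ediv_cancel_left n hg0
    rwa [hmu, hnv] at h1
  refine exists_gl2zEquiv_a_eq_zero_of_isCoprime hcop ?_
  have hscale : f.eval u v = (g : ℤ) ^ 3 * f.eval m n := by
    rw [hm, hn, eval, eval]
    ring
  rw [hscale] at h0
  exact (mul_eq_zero.mp h0).resolve_left (pow_ne_zero 3 hg0)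

/-- Conversely a form with `a = 0` is reducible (`f(1, 0) = 0`). [folklore] -/
theorem not_isIrreducible_of_a_eq_zero {f : BinaryCubic ℤ} (h : f.a = 0) : ¬ f.IsIrreducible :=
  fun hf => hf.1 h

/-- Reducibility is a property of the orbit: `f` is reducible iff some `g ~ f` has `a = 0`. [folklore] -/
theorem not_isIrreducible_iff_exists_gl2zEquiv_a_eq_zero {f : BinaryCubic ℤ} :
    ¬ f.IsIrreducible ↔ ∃ g : BinaryCubic ℤ, GL2ZEquiv f g ∧ g.a = 0 :=
  ⟨exists_gl2zEquiv_a_eq_zero, fun ⟨_, hfg, hg⟩ hf => not_isIrreducible_of_a_eq_zero hg (hfg.isIrreducible_iff.mp hf)⟩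

/-- The shear `u ↦ u + kv`: `(0, 1, c, d) ∘ (1 0; k 1) = (0, 1, c + 2k, k² + ck + d)`
(`v(u² + cuv + dv²) ↦ v((u + kv)² + c(u + kv)v + dv²)`). [folklore] -/
theorem subst_shear (c d k : ℤ) :
    (⟨0, 1, c, d⟩ : BinaryCubic ℤ).subst !![1, 0; k, 1] = ⟨0, 1, c + 2 * k, k ^ 2 + c * k + d⟩ := by
  ext
  · simp [subst]
  · simp [subst]
  · simp [subst]; ring
  · simp [subst]

/-- `(0, 1, c, d) ~ (0, 1, c + 2k, k² + ck + d)`. [folklore] -/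
theorem gl2zEquiv_shear (c d k : ℤ) :
    GL2ZEquiv (⟨0, 1, c, d⟩ : BinaryCubic ℤ) ⟨0, 1, c + 2 * k, k ^ 2 + c * k + d⟩ := by
  refine ⟨!![1, 0; k, 1], by simp [Matrix.det_fin_two_of], ?_⟩
  rw [twist, ← subst_shear]
  simp [Matrix.det_fin_two_of]

/-- `(0, −1, c, d) ~ (0, 1, −c, −d)` (twist by `−1 ∈ GL₂(ℤ)`: `f(−u, −v) = −f(u, v)`). [folklore] -/
theorem gl2zEquiv_neg_b (c d : ℤ) : GL2ZEquiv (⟨0, -1, c, d⟩ : BinaryCubic ℤ) ⟨0, 1, -c, -d⟩ := by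
  refine ⟨!![-1, 0; 0, -1], by simp [Matrix.det_fin_two_of], ?_⟩
  ext <;> simp [twist, subst, Matrix.det_fin_two_of]

/-- **`Disc(0, 1, c, d) = c² − 4d`**: the discriminant of a reducible normal form is the
discriminant of the quadratic factor `u² + cuv + dv²`. [folklore] -/
theorem disc_reducibleNormalForm (c d : ℤ) : (⟨0, 1, c, d⟩ : BinaryCubic ℤ).disc = c ^ 2 - 4 * d := by
  rw [disc_eq]; ring

/-- `Disc(0, b, c, d) = b²(c² − 4bd)`. [folklore] -/
theorem disc_of_a_eq_zero (b c d : ℤ) : (⟨0, b, c, d⟩ : BinaryCubic ℤ).disc = b ^ 2 * (c ^ 2 - 4 * b * d) := by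
  rw [disc_eq]; ring

end BinaryCubic

namespace RingOfForm

/-! ### `R((0, 1, c, d)) ≅ ℤ × ℤ[t]/(t² + ct + d)` -/

/-- **The reducible cubic ring `R((0, 1, c, d))` is `ℤ × S` with `S = ℤ[t]/(t² + ct + d)`**
(Mathlib's `QuadraticAlgebra ℤ (−d) (−c)`, `t² = −d − ct`): for `f = (0, 1, c, d)` the table reads
`ωθ = 0`, `ω² = ω`, `θ² = −d + dω − cθ`, so `ω` is an idempotent, `R = ωR × (1 − ω)R` with
`ωR = ℤω ≅ ℤ` and `(1 − ω)R ∋ θ`, `θ² + cθ + d(1 − ω) = 0`. The isomorphism is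
`x + yω + zθ ↦ (x + y, x + z t)` (BTT 2023, §2.1/§4: non-domains ↔ reducible forms,
maximal ones ↔ `ℚ × K`). [cite: BhargavaTaniguchiThorne2023, §4 (reducible cubic rings ℤ × quadratic ring)] -/
def prodQuadEquiv (c d : ℤ) :
    RingOfForm (⟨0, 1, c, d⟩ : BinaryCubic ℤ) ≃+* ℤ × QuadraticAlgebra ℤ (-d) (-c) where
  toFun P := (P.x + P.y, ⟨P.x, P.z⟩)
  invFun Q := ⟨Q.2.re, Q.1 - Q.2.re, Q.2.im⟩
  left_inv P := by ext <;> simp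
  right_inv Q := by ext <;> simp
  map_mul' P Q := by
    ext
    · simp; ring
    · simp; ring
    · simp; ring
  map_add' P Q := by
    ext
    · simp; ring
    · simp
    · simp

/-- `prodQuadEquiv` on coordinates. [folklore] -/
@[simp] theorem prodQuadEquiv_apply (c d : ℤ) (P : RingOfForm (⟨0, 1, c, d⟩ : BinaryCubic ℤ)) :
    prodQuadEquiv c d P = (P.x + P.y, ⟨P.x, P.z⟩) := rfl

/-- `ω ↦ (1, 0)`: the idempotent. [folklore] -/
theorem prodQuadEquiv_omega (c d : ℤ) : prodQuadEquiv c d (omega _) = (1, 0) := by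
  ext <;> simp

/-- `θ ↦ (0, t)`. [folklore] -/
theorem prodQuadEquiv_theta (c d : ℤ) : prodQuadEquiv c d (theta _) = (0, QuadraticAlgebra.omega) := by
  ext <;> simp [QuadraticAlgebra.omega]

/-! ### The reducible maximal normal form -/

variable {f : BinaryCubic ℤ}

/-- If `R(f)` is maximal and `f = (0, b, c, d)` then no prime divides `b`, i.e. `b = ±1` (the form
itself has `p² ∣ a = 0`, `p ∣ b`, violating `U_p`). [folklore] -/
theorem isUnit_b_of_isMaximal_of_a_eq_zero (hmax : IsMaximal f) (ha : f.a = 0) : IsUnit f.b := by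
  rw [Int.isUnit_iff_natAbs_eq]
  by_contra h1
  have hp := Nat.minFac_prime h1
  set p := f.b.natAbs.minFac
  have hpb : (p : ℤ) ∣ f.b := Int.natCast_dvd.mpr (Nat.minFac_dvd _)
  have hU := memU_of_isMaximal hmax hp.one_lt
  exact hU.2 ⟨f, GL2ZEquiv.refl f, by rw [ha]; exact dvd_zero _, hpb⟩

/-- **Reducible maximal normal form**: if `R(f)` is maximal, `f` is reducible and nondegenerate
(`Disc f ≠ 0`), then `f ~ (0, 1, c, d)` for some `c ∈ {0, 1}` and `d` (with `Disc f = c² − 4d`):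
move a zero to `(1 : 0)` (`a = 0`), use maximality to get `b = ±1`, the twist by `−1` to get
`b = 1`, and a shear to reduce `c` modulo `2`. [cite: BhargavaTaniguchiThorne2023, §4 (maximal reducible rings ↔ ℤ × maximal quadratic ring)] -/
theorem exists_normalForm_of_isMaximal (hmax : IsMaximal f) (hred : ¬ f.IsIrreducible) (hdisc : f.disc ≠ 0) :
    ∃ c d : ℤ, (c = 0 ∨ c = 1) ∧ GL2ZEquiv f ⟨0, 1, c, d⟩ := by
  obtain ⟨g, hfg, hga⟩ := exists_gl2zEquiv_a_eq_zero hred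
  obtain ⟨a', b, c, d⟩ := g
  simp only at hga
  subst hga
  -- `b ≠ 0` by nondegeneracy, and `b = ±1` by maximality
  have hb0 : b ≠ 0 := by
    intro hb
    apply hdisc
    rw [← hfg.disc_eq, hb, disc_of_a_eq_zero]
    ring
  have hbu : IsUnit b := isUnit_b_of_isMaximal_of_a_eq_zero (hmax.of_gl2zEquiv hfg) rfl
  -- reduce to `b = 1`
  have h1 : ∃ c' d' : ℤ, GL2ZEquiv f ⟨0, 1, c', d'⟩ := by
    rcases Int.isUnit_iff.mp hbu with rfl | rfl
    · exact ⟨c, d, hfg⟩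
    · exact ⟨-c, -d, hfg.trans (gl2zEquiv_neg_b c d)⟩
  obtain ⟨c', d', h⟩ := h1
  -- shear by `k = −(c' / 2)`: `c' + 2k = c' % 2 ∈ {0, 1}`
  refine ⟨c' % 2, (-(c' / 2)) ^ 2 + c' * (-(c' / 2)) + d', ?_, ?_⟩
  · rcases Int.emod_two_eq_zero_or_one c' with h0 | h0 <;> simp [h0]
  · have hk : c' + 2 * (-(c' / 2)) = c' % 2 := by omega
    rw [← hk]
    exact h.trans (gl2zEquiv_shear c' d' (-(c' / 2)))

/-- Hence **a maximal reducible nondegenerate cubic ring is `ℤ × S`** with `S = ℤ[t]/(t² + ct + d)`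
the quadratic ring of discriminant `Disc(f) = c² − 4d`. [cite: BhargavaTaniguchiThorne2023, §4 (reducible maximal cubic rings)] -/
theorem exists_ringEquiv_prod_quadraticAlgebra (hmax : IsMaximal f) (hred : ¬ f.IsIrreducible) (hdisc : f.disc ≠ 0) :
    ∃ c d : ℤ, (c = 0 ∨ c = 1) ∧ f.disc = c ^ 2 - 4 * d ∧
      Nonempty (RingOfForm f ≃+* ℤ × QuadraticAlgebra ℤ (-d) (-c)) := by
  obtain ⟨c, d, hc, h⟩ := exists_normalForm_of_isMaximal hmax hred hdisc
  obtain ⟨e⟩ := nonempty_ringEquiv_of_gl2zEquiv h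
  exact ⟨c, d, hc, by rw [← h.disc_eq, disc_reducibleNormalForm], ⟨e.symm.trans (prodQuadEquiv c d)⟩⟩

end RingOfForm

end Literature.NumberTheory.CubicFields
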